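import Mathlib
import Summits.AtomisticToContinuum.Crystallization.Theses.ExcessDecayLiouville

/-!
# Sketch — crux `HcpLiouville` (stmt-AtomisticToContinuum-9332), crux-ideate round 1, ideator 3 (generation 2)

First-lemma statements (elaborating, not proved) of the crux idea card
`abel-dressed-bloch-certificate`:

* `TubeStable η κ` — the ONE inequality every energy-method line on this crux consumes (ideator 2's
  `TangentTubeStability η` with the constant exposed; gen-1 ideator 3's `MonotoneBall`; ideator 1's
  `BoxCoercive`): harmonic stability of Lennard-Jones at EVERY configuration of the sup-norm tube of
  radius `η` around an admissible hcp two-lattice.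
* `AbelBound` — the analytic heart of the card (provable now): summation by parts of a bounded sequence
  against a finitely supported one, `|Σ (Φ(i+1) − Φ i) f i| ≤ M · Σ |f i − f (i−1)|`.
* `StiffnessConvex`, `TransverseChord` — the two scalar Lennard-Jones facts that make the background
  dependence of the bond force constants AFFINE in the longitudinal background strain up to constant,
  sign-definite residues (interval arithmetic / `nlinarith` targets).
* `PolarisedAffineMinorant` — the per-bond input shape: the displaced bond form dominates a polarised
  quadratic form whose coefficients are affine in `ê·d`.
* `rowCharge`, `DressedBloch`, `DressedReduction` — the reduction: a dressed quadratic inequality on the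
  PERIODIC reference two-lattice (first and second differences of the test field along the in-plane
  close-packed rows; one 6×6 Bloch family) implies `TubeStable`.
-/

namespace Summit.AtomisticToContinuum.Crystallization.Cruxes.HcpLiouville.IdeatorThreeG2

open scoped BigOperators
open Literature.MathematicalPhysics.StatisticalMechanics

local notation "E3" => EuclideanSpace ℝ (Fin 3)

/-- The hexagonal period lattice `Λ` of the unit hcp stacking (verbatim from the route file). -/
def Lam : Set E3 :=
  {z | ∃ i j k : ℤ, z = (i : ℝ) • triangularVec₁ 1 + (j : ℝ) • triangularVec₂ 1 +
    (k : ℝ) • layerNormal (2 * Real.sqrt (2 / 3))}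

/-- Admissible cell (route file). -/
def Adm (A : E3 →L[ℝ] E3) : Prop :=
  ∃ R : E3 ≃ₗᵢ[ℝ] E3, ‖A - (97 / 100 : ℝ) • (R.toContinuousLinearEquiv : E3 →L[ℝ] E3)‖ ≤ 1 / 40

/-- hcp-like inner displacement (route file). -/
def Inner (t : Fin 2 → E3) (A : E3 →L[ℝ] E3) : Prop :=
  ‖t 1 - t 0 - A (barlowOffset 1 + layerNormal (Real.sqrt (2 / 3)))‖ ≤ 1 / 40

/-- Site set of the datum `(t, A)` (route file). -/
def Sites (t : Fin 2 → E3) (A : E3 →L[ℝ] E3) : Set E3 :=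
  {p | ∃ m : Fin 2, ∃ z ∈ Lam, p = t m + A z}

/-- Bond Hessian `w ↦ wᵀ K(e) w` of the LJ pair term (route file). -/
noncomputable def Hess (e w : E3) : ℝ :=
  deriv (deriv lennardJones) ‖e‖ * (inner ℝ e w / ‖e‖) ^ 2 +
    deriv lennardJones ‖e‖ / ‖e‖ * (‖w‖ ^ 2 - (inner ℝ e w / ‖e‖) ^ 2)

/-- Nearest-neighbour PAIR strain norm of a test field on the sites (the crux's left-hand side without `κ`;
ordered double sum = twice the sum over nn pairs). -/
noncomputable def strainNorm (S : Set E3) (v : E3 → E3) : ℝ :=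
  ∑' p : S, ∑' q : S, if dist (p : E3) q ≤ 11 / 10 then ‖v p - v q‖ ^ 2 else 0

/-- The LJ second variation at the configuration `S + u` (sites displaced by the background `u`),
tested on `v` (the crux's right-hand side with displaced bonds). -/
noncomputable def secondVariation (S : Set E3) (u v : E3 → E3) : ℝ :=
  (∑' p : S, ∑' q : S,
    if (p : E3) ≠ q then Hess (((p : E3) + u p) - ((q : E3) + u q)) (v p - v q) else 0) / 2

/-- TUBE STABILITY with explicit constant: harmonic (tangent) stability of Lennard-Jones at EVERY
configuration of the sup-norm tube of radius `η` around every admissible hcp-like two-lattice, uniformly.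
`∃ κ > 0, TubeStable η κ` is ideator 2's `TangentTubeStability η`; at `η = 0` it is `PhononStability`. -/
def TubeStable (η κ : ℝ) : Prop :=
  ∀ (t : Fin 2 → E3) (A : E3 →L[ℝ] E3), Adm A → Inner t A →
    ∀ u : E3 → E3, (∀ p ∈ Sites t A, ‖u p‖ ≤ η) →
      ∀ v : E3 → E3, (Function.support v).Finite → Function.support v ⊆ Sites t A →
        κ * strainNorm (Sites t A) v ≤ secondVariation (Sites t A) u v

/-- ABEL BOUND (the card's lever, provable now): a bounded sequence summed by parts against a finitely
supported one. Applied along each close-packed row with `Φ i = ê · u(p₀ + i e)` (the longitudinal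
component of the BACKGROUND displacement, `|Φ i| ≤ η`) and `f i` = a quadratic expression in the test
field on the `i`-th bond of the row, it converts "coefficient perturbation linear in the background bond
strain `Φ(i+1) − Φ i`" into "η × total variation of `f` along the row" — a quantity of the TEST field on
the REFERENCE lattice. -/
def AbelBound : Prop :=
  ∀ (Φ f : ℤ → ℝ) (M : ℝ), (∀ i, |Φ i| ≤ M) → (Function.support f).Finite →
    |∑ᶠ i, (Φ (i + 1) - Φ i) * f i| ≤ M * ∑ᶠ i, |f i - f (i - 1)|

/-- LJ FACT 1 (interval arithmetic target): `V⁗ ≥ 0` on `(0, 1.32]` (`V⁗ = 2730 r⁻¹⁶ − 504 r⁻¹⁰`,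
zero at `(2730/504)^{1/6} ≈ 1.325`). Hence the longitudinal stiffness `k = V″` and `k − t` are CONVEX on
the whole nearest-neighbour tube range `[0.82, 1.12]`: compression stiffening is at least linear in the
longitudinal background strain — the tangent line at the reference length is a minorant with ZERO residue. -/
def StiffnessConvex : Prop :=
  ∀ r : ℝ, 0 < r → r ≤ 132 / 100 → 0 ≤ iteratedDeriv 4 lennardJones r

/-- LJ FACT 2 (interval arithmetic target): the transverse bond stiffness `t(r) = V′(r)/r` is concave on
`[0.82, 1.12]` (`t″ = (V‴ − 2t′)/r < 0` there), so on every window `[ℓ − d, ℓ + d]` its CHORD is an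
affine minorant in the longitudinal strain `ε`; the price is the constant midpoint defect
`t(ℓ) − (t(ℓ+d) + t(ℓ−d))/2` (`= 0.33` at `ℓ = 0.97, d = 0.05`; `0.53` at `ℓ = 0.945`). -/
def TransverseChord : Prop :=
  ∀ ℓ d ε : ℝ, 92 / 100 ≤ ℓ → ℓ ≤ 102 / 100 → 0 < d → d ≤ 1 / 10 → |ε| ≤ d →
    (deriv lennardJones (ℓ + d) / (ℓ + d) + deriv lennardJones (ℓ - d) / (ℓ - d)) / 2 +
        (deriv lennardJones (ℓ + d) / (ℓ + d) - deriv lennardJones (ℓ - d) / (ℓ - d)) / (2 * d) * ε ≤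
      deriv lennardJones (ℓ + ε) / (ℓ + ε)

/-- PER-BOND INPUT SHAPE: for a reference bond `e` of length `ℓ` and every background bond difference
`d` with `‖d‖ ≤ 2η`, the displaced bond form `Hess (e + d)` dominates a POLARISED quadratic form whose
longitudinal / transverse coefficients are AFFINE in the longitudinal background strain `ê·d`
(`α₀ + α₁ ê·d` from `StiffnessConvex` + the Schur envelope over the transverse part of `d`;
`β₀ + β₁ ê·d` from `TransverseChord`). The numbers are produced per bond class by calculus / interval
arithmetic (kit `dressed_bloch.py` computes them in floats). -/
def PolarisedAffineMinorant (η ℓ α₀ α₁ β₀ β₁ : ℝ) : Prop :=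
  ∀ e d v : E3, ‖e‖ = ℓ → ‖d‖ ≤ 2 * η →
    (α₀ + α₁ * (inner ℝ e d / ℓ)) * (inner ℝ e v / ℓ) ^ 2 +
        (β₀ + β₁ * (inner ℝ e d / ℓ)) * (‖v‖ ^ 2 - (inner ℝ e v / ℓ) ^ 2) ≤
      Hess (e + d) v

/-- ROW CHARGE of a test field `v` along the row direction `e` (what Abel summation costs, after the
relaxation `|x² − x'²| ≤ (x − x')²/(2μ) + μ (x + x')²/2`): a translation-invariant quadratic form in `v`
built from FIRST and SECOND differences along the row — hence Bloch-reducible on the periodic reference. -/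
noncomputable def rowCharge (S : Set E3) (e : E3) (ca cb μ : ℝ) (v : E3 → E3) : ℝ :=
  ∑' p : S,
    (ca * ((inner ℝ e (v ((p : E3) + e) - v p) / ‖e‖ - inner ℝ e (v p - v ((p : E3) - e)) / ‖e‖) ^ 2 / (2 * μ) +
            μ * (inner ℝ e (v ((p : E3) + e) - v p) / ‖e‖ + inner ℝ e (v p - v ((p : E3) - e)) / ‖e‖) ^ 2 / 2) +
      cb * (‖(v ((p : E3) + e) - v p) - (v p - v ((p : E3) - e))‖ ^ 2 / (2 * μ) +
            μ * ‖(v ((p : E3) + e) - v p) + (v p - v ((p : E3) - e))‖ ^ 2 / 2))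

/-- The DRESSED BLOCH INEQUALITY at radius `η` with constant `κ` (a statement about the REFERENCE
two-lattices only; one 6×6 Bloch family per datum, certified like `PhononStability` 9333).
Data: per-bond polarised coefficients `α₀ α₁ β₀ β₁` (functions of the reference bond vector) valid in the
sense of `PolarisedAffineMinorant` for the in-plane nearest-neighbour bonds (rows `±A u₁, ±A u₂,
±A(u₂ − u₁)`), bondwise (strain-independent) minorants `α β` for the out-of-plane nearest-neighbour bonds
(hcp has no straight out-of-plane bond chains — `HcpNotBravais`), an operator-norm defect `Δ` for the far
bonds, and a relaxation weight `μ > 0`; the inequality: reference polarised form MINUS `η ×` row charges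
dominates `κ ×` the pair strain norm, for every finitely supported test field. -/
def DressedBloch (η κ : ℝ) : Prop :=
  ∃ (α₀ α₁ β₀ β₁ α β Δ : E3 → ℝ) (μ : ℝ), 0 < μ ∧
    (∀ e : E3, 92 / 100 ≤ ‖e‖ → ‖e‖ ≤ 102 / 100 →
        PolarisedAffineMinorant η ‖e‖ (α₀ e) (α₁ e) (β₀ e) (β₁ e) ∧
          PolarisedAffineMinorant η ‖e‖ (α e) 0 (β e) 0) ∧
    (∀ e d v : E3, 11 / 10 < ‖e‖ → ‖d‖ ≤ 2 * η → Hess e v - Δ e * ‖v‖ ^ 2 ≤ Hess (e + d) v) ∧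
    ∀ (t : Fin 2 → E3) (A : E3 →L[ℝ] E3), Adm A → Inner t A →
      ∀ v : E3 → E3, (Function.support v).Finite → Function.support v ⊆ Sites t A →
        κ * strainNorm (Sites t A) v +
            η * (∑ e ∈ ({A (triangularVec₁ 1), A (triangularVec₂ 1), A (triangularVec₂ 1 - triangularVec₁ 1),
                    -A (triangularVec₁ 1), -A (triangularVec₂ 1), -A (triangularVec₂ 1 - triangularVec₁ 1)} :
                    Finset E3),
                  rowCharge (Sites t A) e (|α₁ e|) (|β₁ e|) μ v) / 2 ≤
          (∑' p : Sites t A, ∑' q : Sites t A,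
              if (p : E3) ≠ q then
                (if dist (p : E3) q ≤ 11 / 10 then
                    (if |inner ℝ ((q : E3) - p) (layerNormal (1 : ℝ))| ≤ 1 / 10 then
                        α₀ ((q : E3) - p) * (inner ℝ ((q : E3) - p) (v q - v p) / ‖(q : E3) - p‖) ^ 2 +
                          β₀ ((q : E3) - p) *
                            (‖v q - v p‖ ^ 2 - (inner ℝ ((q : E3) - p) (v q - v p) / ‖(q : E3) - p‖) ^ 2)
                      else
                        α ((q : E3) - p) * (inner ℝ ((q : E3) - p) (v q - v p) / ‖(q : E3) - p‖) ^ 2 +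
                          β ((q : E3) - p) *
                            (‖v q - v p‖ ^ 2 - (inner ℝ ((q : E3) - p) (v q - v p) / ‖(q : E3) - p‖) ^ 2))
                  else Hess ((q : E3) - p) (v q - v p) - Δ ((q : E3) - p) * ‖v q - v p‖ ^ 2)
              else 0) / 2

/-- THE REDUCTION (the card's first lemma proper; size M, pure algebra: per-bond minorants, Abel along
each in-plane row with `Φ = ê·u`, the relaxation of the total variation, and bookkeeping of absolutely
summable double sums): a dressed Bloch certificate at radius `η` IS tube stability at radius `η`. -/
def DressedReduction : Prop := ∀ η κ : ℝ, 0 < η → DressedBloch η κ → TubeStable η κ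

/-- What the card feeds the sibling lines: at `η = 1/20` (ideators 1, 2) resp. `7/160` (gen-1 ideator 3)
the certified constant is the hypothesis `BoxCoercive` / `TangentTubeStability` / `MonotoneBall` of the
three energy-method lines, whose own chains end in the crux. Recorded as the target shape. -/
def LineShape : Prop :=
  ∀ κ : ℝ, 0 < κ → DressedBloch (1 / 20) κ → DressedReduction → TubeStable (1 / 20) κ

example : LineShape := fun κ _ hD hR => hR (1 / 20) κ (by norm_num) hD

end Summit.AtomisticToContinuum.Crystallization.Cruxes.HcpLiouville.IdeatorThreeG2
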